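import Summits.BirchSwinnertonDyer.BirchSwinnertonDyer.Theorems.GoldfeldAllTwistsTwoConverseTwinBirchTamagawa
import HarnessLib

set_option linter.dupNamespace false -- `…BirchSwinnertonDyer.BirchSwinnertonDyer…` is the cell's namespace (D-0017)
set_option autoImplicit false

/-!
# LINE B49 — THEOREM B′ (family F2, `d_K = −8q`), local input (B1a′): the global minimal model
# `[0, 6q, 0, −128q², 512q³]` of `49a1^{(−2q)}`, and its Tamagawa numbers `c₇ = 2`, `c_q = 2` at the odd places

Cell `bsd-goldfeld`, seat `bsd-goldfeld-s1p-c301` (prover, gen 9); planner ruling g25 (cii) (THEOREM B′ = clause (ii)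
of `X049BirchLemmaEvenDiscrEight` on the family F2), scope memo `HOME/GENUS-THEOREM-B-PRIME.md` factors F8/F9
(`|u| = 1`, `c_W = c₂·c₇·c_q = 16`). Support for item `stmt-BirchSwinnertonDyer-19140` (twin″); Theses-free; theorems
only. HONEST FRAMING: local arithmetic of an explicit family of Weierstrass models; nothing about `L`-values or BSD.
The F1 twin of this file is `…TwinBirchLocal` (model `[0, 3q, 0, −32q², 64q³]` of `49a1^{(−q)}`).

Throughout `q` is an odd prime with `(q/7) = −1` (inert in `ℚ(√−7)`; for the `q`-adic count also `q ≡ 1 (mod 4)`, the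
family F2), and `V′_q = X₀(49)^{(−8q)} = cm7.quadraticTwist (−8q) = [0, 6q, 0, −128q², 512q³]` (the tree's twist model at
the discriminant `d_K = −8q` of `K = ℚ(√−2q)`; every model `W = Cd • X₀(49)^{(d_K)}` of seat c301's
`X049BirchLemmaEvenDiscrEight` is `ℚ`-isomorphic to it). WHAT IS PROVED:
* §0 `V′_q` is the base change of the integer model `[0, 6q, 0, −128q², 512q³]`, with `c₄ = 2⁶·105·q²`,
  `c₆ = 64·(−10584 q³)`, `Δ = −2¹⁸·7³·q⁶`; it is GLOBALLY MINIMAL for every odd prime `q ≠ 7`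
  (`isGloballyMinimal_twistModelEight`: the Kraus-at-`2` test of seat c3's file III — `2⁸ ∤ c₄` as `q` is odd,
  `−10584q³ + 1 ≡ 1 (mod 4)` — and `p¹² ∤ Δ` at odd `p`). (Kit j273920, PARI: `u = 1` between `V′_q` and
  `ellminimalmodel` for all 20 test primes.)
* §1 **`c₇(V′_q) = 2`**: `−8q` is a `7`-adic unit square (`(−8q/7) = (−1/7)(2/7)(q/7) = +1`, Serre II.3.3 Thm 3 =
  tree `padicInt_isSquare_unit_iff_toZMod`), so `V′_q ≅ X₀(49)^{(1)} ≅ X₀(49)` over `ℚ₇` (file B1a's square-class lemma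
  `localTamagawaNumber_padic_quadraticTwist_eq_of_sq`) and `c₇(X₀(49)) = 2` (file B1a's type-`III` certificate).
* §2 **`c_q(V′_q) = 2`** for `q ≡ 1 (mod 4)`: over `ℤ_q` the model is Tate's Step-6 normal form (`a₂ = q·6`,
  `a₄ = q²·(−128)`, `a₆ = q³·512`) with SEPARABLE residue cubic `T³ + 6T² − 128T + 512 = (T + 16)(T² − 10T + 32)`
  (discriminant `−2¹⁴·7³ ≢ 0 (mod q)`), whose only root in `𝔽_q` is `−16` since `(T − 5)² = −7` has no solution
  (`(−7/q) = −1`); the exact `I₀*` count `[E(ℚ_q) : E₀(ℚ_q)] = 1 + #roots = 2`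
  (`Rank2Observatory.Tam.index_Istar_zero_eq_card_add_one`), read as `c_q` on the minimal model.
The place `2` (`c₂ = 4` on both `ℚ₂`-classes) and the assembly `Tam = 16` are the sibling file `…TwinBirchLocalTen`.
References: [Silverman1994] IV.9.4 Steps 2–6 and Table 4.1; [Tate1975] §7; [SilvermanAEC2009] VII.1, VII.6, X.5
Cor. 5.4; [Serre1973] II.3.3; [Kraus1989] Prop. 2; [CremonaAlgorithms1997] Table 1 (N = 49: `c₇ = 2`).
-/

noncomputable section

open scoped Classical NumberField

open WeierstrassCurve IsDedekindDomain IsLocalRing Rat.HeightOneSpectrum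
  Literature.NumberTheory.EllipticCurves Literature.NumberTheory.EllipticCurves.ModularForms
  Literature.NumberTheory.QuadraticForms
  Summit.BirchSwinnertonDyer.BirchSwinnertonDyer.Rank2Observatory.Tate
  Summit.BirchSwinnertonDyer.BirchSwinnertonDyer.Rank2Observatory.RootNumber
  Summit.BirchSwinnertonDyer.BirchSwinnertonDyer.Rank2Observatory.Tam

namespace Summit.BirchSwinnertonDyer.BirchSwinnertonDyer.Theorems.GoldfeldGoodTwists

/-! ## §0 The integer model `[0, 6q, 0, −128q², 512q³]` of `X₀(49)^{(−8q)}` and its global minimality -/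

section ModelEight

variable (q : ℕ)

/-- `[0, 6q, 0, −128q², 512q³] ⊗ ℚ = X₀(49)^{(−8q)}` (`b₂(cm7) = −3`, `b₄ = −4`, `b₆ = −4`). [cite: SilvermanAEC2009, X.5 Cor. 5.4] -/
theorem twistModelEight_baseChange :
    (⟨0, 6 * q, 0, -128 * q ^ 2, 512 * q ^ 3⟩ : WeierstrassCurve ℤ).baseChange ℚ =
      cm7.quadraticTwist ((-(8 * q) : ℤ) : ℚ) := by
  ext <;> simp [baseChange, quadraticTwist, b₂, b₄, b₆] <;> ring

/-- `c₄ = 6720 q² = 2⁶·105·q²`. [folklore] -/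
theorem twistModelEight_c₄ : (⟨0, 6 * q, 0, -128 * q ^ 2, 512 * q ^ 3⟩ : WeierstrassCurve ℤ).c₄ = 6720 * q ^ 2 := by
  simp [WeierstrassCurve.c₄, b₂, b₄]; ring

/-- `c₆ = −677376 q³ = 64·(−10584 q³)`. [folklore] -/
theorem twistModelEight_c₆ :
    (⟨0, 6 * q, 0, -128 * q ^ 2, 512 * q ^ 3⟩ : WeierstrassCurve ℤ).c₆ = 64 * (-10584 * q ^ 3) := by
  simp [WeierstrassCurve.c₆, b₂, b₄, b₆]; ring

/-- `Δ = −2¹⁸·7³·q⁶`. [folklore] -/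
theorem twistModelEight_Δ :
    (⟨0, 6 * q, 0, -128 * q ^ 2, 512 * q ^ 3⟩ : WeierstrassCurve ℤ).Δ = -(2 ^ 18 * 7 ^ 3 * q ^ 6) := by
  simp [WeierstrassCurve.Δ, b₂, b₄, b₆, b₈]; ring

variable {q}

/-- A prime dividing `Δ = −2¹⁸7³q⁶` is `2`, `7` or `q`. [folklore] -/
theorem eq_of_prime_dvd_twistModelEight_Δ (hq : q.Prime) {p : ℕ} (hp : p.Prime)
    (h : (p : ℤ) ∣ (⟨0, 6 * q, 0, -128 * q ^ 2, 512 * q ^ 3⟩ : WeierstrassCurve ℤ).Δ) :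
    p = 2 ∨ p = 7 ∨ p = q := by
  rw [twistModelEight_Δ, dvd_neg] at h
  have h' : p ∣ 2 ^ 18 * 7 ^ 3 * q ^ 6 := by exact_mod_cast h
  rcases (Nat.Prime.dvd_mul hp).mp h' with h1 | h1
  · rcases (Nat.Prime.dvd_mul hp).mp h1 with h2 | h2
    · exact Or.inl ((Nat.prime_dvd_prime_iff_eq hp Nat.prime_two).mp (hp.dvd_of_dvd_pow h2))
    · exact Or.inr (Or.inl ((Nat.prime_dvd_prime_iff_eq hp (by norm_num)).mp (hp.dvd_of_dvd_pow h2)))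
  · exact Or.inr (Or.inr ((Nat.prime_dvd_prime_iff_eq hp hq).mp (hp.dvd_of_dvd_pow h1)))

/-- **`V′_q = [0, 6q, 0, −128q², 512q³]` is a global minimal model of `49a1^{(−2q)}`** for every ODD prime `q ≠ 7`:
Kraus at `2` (`2⁸ ∤ 2⁶·105·q²`; `c₆/64 + 1 = 1 − 10584q³ ≡ 1 (mod 4)`) and `p¹² ∤ 2¹⁸7³q⁶` for odd `p`. No condition on
`q mod 4` is needed. [cite: Kraus1989, Prop. 2] [cite: SilvermanAEC2009, VII.1 Remark 1.1] -/
theorem isGloballyMinimal_twistModelEight (hq : q.Prime) (hq2 : q ≠ 2) (hq7 : q ≠ 7) :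
    ((⟨0, 6 * q, 0, -128 * q ^ 2, 512 * q ^ 3⟩ : WeierstrassCurve ℤ).baseChange ℚ).IsGloballyMinimal := by
  have hq2' : q % 2 = 1 := Nat.odd_iff.mp (hq.odd_of_ne_two hq2)
  have hqodd : Odd (q : ℤ) := by exact_mod_cast Nat.odd_iff.mpr hq2'
  refine isGloballyMinimal_baseChange_int_of_kraus _ (d := -10584 * q ^ 3) ?_ (twistModelEight_c₆ q) ?_ ?_
  · -- `2⁸ ∤ 6720 q² = 2⁶ · 105 q²`
    rw [twistModelEight_c₄]
    intro h
    have h64 : (2 : ℤ) ^ 8 = 64 * 4 := by norm_num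
    rw [h64, show (6720 : ℤ) * q ^ 2 = 64 * (105 * q ^ 2) by ring] at h
    have h2 : (4 : ℤ) ∣ 105 * q ^ 2 := (mul_dvd_mul_iff_left (by norm_num)).mp h
    have hodd : Odd ((105 : ℤ) * q ^ 2) := (by decide : Odd (105 : ℤ)).mul (hqodd.pow)
    exact (Int.not_even_iff_odd.mpr hodd) (even_iff_two_dvd.mpr (dvd_trans ⟨2, by norm_num⟩ h2))
  · -- `4 ∤ −10584 q³ + 1`
    intro h
    norm_num at h
    omega
  · -- odd primes: `p¹² ∤ 2¹⁸·7³·q⁶`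
    intro p hp hp2 h
    rw [twistModelEight_Δ, dvd_neg] at h
    have h' : p ^ 12 ∣ 2 ^ 18 * 7 ^ 3 * q ^ 6 := by exact_mod_cast h
    have hcop2 : Nat.Coprime (p ^ 12) (2 ^ 18) :=
      Nat.Coprime.pow _ _ ((Nat.coprime_primes hp Nat.prime_two).mpr hp2)
    rw [mul_assoc] at h'
    have h'' : p ^ 12 ∣ 7 ^ 3 * q ^ 6 := hcop2.dvd_of_dvd_mul_left h'
    by_cases hp7 : p = 7
    · subst hp7
      have hcop : Nat.Coprime (7 ^ 9) (q ^ 6) :=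
        Nat.Coprime.pow _ _ ((Nat.coprime_primes (by norm_num) hq).mpr (Ne.symm hq7))
      have h3 : 7 ^ 3 * 7 ^ 9 ∣ 7 ^ 3 * q ^ 6 := by rw [← pow_add]; exact h''
      have h4 : 7 ^ 9 ∣ q ^ 6 := (Nat.mul_dvd_mul_iff_left (by norm_num)).mp h3
      have h5 := Nat.Coprime.eq_one_of_dvd hcop h4
      norm_num at h5
    · have hcop7 : Nat.Coprime (p ^ 12) (7 ^ 3) :=
        Nat.Coprime.pow _ _ ((Nat.coprime_primes hp (by norm_num)).mpr hp7)
      have h3 : p ^ 12 ∣ q ^ 6 := hcop7.dvd_of_dvd_mul_left h''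
      have hpq : p ∣ q := hp.dvd_of_dvd_pow (dvd_trans (dvd_pow_self p (by norm_num)) h3)
      have hpq' : p = q := (Nat.prime_dvd_prime_iff_eq hp hq).mp hpq
      subst hpq'
      have h4 := (Nat.pow_dvd_pow_iff_le_right hp.one_lt).mp h3
      omega

/-- **`X₀(49)^{(−8q)}` is globally minimal** for every odd prime `q ≠ 7` (transport along `twistModelEight_baseChange`):
the factor `|u|` of `𝔮₄₉` on the family F2 will be `1`. [cite: Kraus1989, Prop. 2] -/
theorem isGloballyMinimal_cm7_quadraticTwist_negEightMul (hq : q.Prime) (hq2 : q ≠ 2) (hq7 : q ≠ 7) :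
    (cm7.quadraticTwist (((-(8 * q) : ℤ)) : ℚ)).IsGloballyMinimal := by
  rw [← twistModelEight_baseChange]
  exact isGloballyMinimal_twistModelEight hq hq2 hq7

end ModelEight

/-! ## §1 The place `7`: `c₇(V′_q) = 2` -/

section SevenEight

/-- `(−8q/7) = +1` for `(q/7) = −1`: `−8q` is a square unit in `ℤ₇`, so `−8q = 1 · θ²` in `ℚ₇` with `θ ≠ 0`
(`(−1/7) = −1`, `(2/7) = +1`). [cite: Serre1973, Ch. II §3.3 Thm 3] -/
theorem exists_sq_eq_neg_eight_mul_padic_seven {q : ℕ} (hq : q.Prime) (hq7 : jacobiSym q 7 = -1) :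
    haveI : Fact (Nat.Prime 7) := ⟨by norm_num⟩
    ∃ θ : ℚ_[7], θ ≠ 0 ∧ ((((-(8 * q) : ℤ)) : ℚ) : ℚ_[7]) = (1 : ℚ) * θ ^ 2 := by
  haveI : Fact (Nat.Prime 7) := ⟨by norm_num⟩
  obtain ⟨hq2, hq7'⟩ := ne_two_and_ne_seven_of_jacobiSym hq7
  -- `−8q` is a `7`-adic unit
  have hndvd : ¬ (7 : ℤ) ∣ (-(8 * q) : ℤ) := by
    rw [dvd_neg]
    intro h
    have h' : 7 ∣ 8 * q := by exact_mod_cast h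
    rcases (Nat.Prime.dvd_mul (by norm_num)).mp h' with h8 | h8
    · norm_num at h8
    · exact hq7' ((Nat.prime_dvd_prime_iff_eq (by norm_num) hq).mp h8).symm
  have hU : IsUnit (((-(8 * q) : ℤ)) : ℤ_[7]) := by
    rw [PadicInt.isUnit_iff]
    have hle := PadicInt.norm_le_one (((-(8 * q) : ℤ)) : ℤ_[7])
    have hlt : ¬ ‖(((-(8 * q) : ℤ)) : ℤ_[7])‖ < 1 := fun h =>
      hndvd ((PadicInt.norm_int_lt_one_iff_dvd _).mp (by exact_mod_cast h))
    exact le_antisymm hle (not_lt.mp hlt)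
  -- its residue is a square: `legendreSym 7 (−8q) = (−1/7)(4/7)(2/7)(q/7) = (−1)(1)(1)(−1) = 1`
  have h2z : ((2 : ℤ) : ZMod 7) ≠ 0 := fun h => by
    have h' := (ZMod.intCast_zmod_eq_zero_iff_dvd 2 7).mp h
    omega
  have hleg2 : legendreSym 7 2 = 1 := by
    rw [jacobiSym.legendreSym.to_jacobiSym]; norm_num
  have hleg : legendreSym 7 (-(8 * q) : ℤ) = 1 := by
    rw [show (-(8 * q) : ℤ) = -1 * (2 ^ 2 * (2 * q)) by ring, legendreSym.mul, legendreSym.mul,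
      legendreSym.mul, legendreSym.at_neg_one (by norm_num), ZMod.χ₄_nat_three_mod_four (by norm_num),
      legendreSym.sq_one' 7 h2z, hleg2, jacobiSym.legendreSym.to_jacobiSym, hq7]
    norm_num
  have hres0 : (((-(8 * q) : ℤ)) : ZMod 7) ≠ 0 := by
    intro h
    have h' : ((7 : ℕ) : ℤ) ∣ (-(8 * q) : ℤ) := (ZMod.intCast_zmod_eq_zero_iff_dvd _ 7).mp h
    exact hndvd (by exact_mod_cast h')
  have hsqZ : IsSquare ((((-(8 * q) : ℤ)) : ZMod 7)) := (legendreSym.eq_one_iff 7 hres0).mp hleg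
  have hsq : IsSquare (((-(8 * q) : ℤ)) : ℤ_[7]) := by
    have h := (padicInt_isSquare_unit_iff_toZMod (p := 7) (by norm_num) hU.unit).mpr (by
      rw [IsUnit.unit_spec, map_intCast]; exact hsqZ)
    rwa [IsUnit.unit_spec] at h
  obtain ⟨s, hs⟩ := hsq
  refine ⟨(s : ℚ_[7]), ?_, ?_⟩
  · intro hs0
    rw [PadicInt.coe_eq_zero] at hs0
    rw [hs0, mul_zero] at hs
    exact hU.ne_zero hs
  · rw [Rat.cast_one, one_mul, sq, ← PadicInt.coe_mul, ← hs, PadicInt.coe_intCast]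
    push_cast
    ring

/-- **`c₇(V′_q) = 2`** for `V′_q = X₀(49)^{(−8q)}`, `q` prime with `(q/7) = −1`: over `ℚ₇`, `V′_q ≅ X₀(49)^{(1)} ≅ X₀(49)`
(§1 with `−8q = 1·θ²`; `completeSquare_smul_cm7`), and `c₇(X₀(49)) = 2` (file B1a).
[cite: SilvermanAEC2009, X.5 Cor. 5.4 and VII.6] [cite: CremonaAlgorithms1997, Table 1 (N = 49)] -/
theorem localTamagawaNumber_padic_twistEight_seven {q : ℕ} (hq : q.Prime) (hq7 : jacobiSym q 7 = -1) :
    (haveI : Fact (Nat.Prime 7) := ⟨by norm_num⟩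
     haveI := cm7.isElliptic_quadraticTwist (show (((-(8 * q) : ℤ)) : ℚ) ≠ 0 by
       have := hq.pos; exact_mod_cast (show (-(8 * (q : ℤ))) ≠ 0 by omega))
     ((cm7.quadraticTwist (((-(8 * q) : ℤ)) : ℚ)).baseChange ℚ_[7]).localTamagawaNumber ℤ_[7]) = 2 := by
  haveI : Fact (Nat.Prime 7) := ⟨by norm_num⟩
  have hd : (((-(8 * q) : ℤ)) : ℚ) ≠ 0 := by
    have := hq.pos; exact_mod_cast (show (-(8 * (q : ℤ))) ≠ 0 by omega)
  obtain ⟨θ, hθ, h⟩ := exists_sq_eq_neg_eight_mul_padic_seven hq hq7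
  rw [localTamagawaNumber_padic_quadraticTwist_eq_of_sq cm7 one_ne_zero hd hθ h]
  -- `X₀(49)^{(1)} = C • X₀(49)` over `ℚ`, hence over `ℚ₇`
  haveI := cm7.isElliptic_quadraticTwist (one_ne_zero (α := ℚ))
  have e : (cm7.quadraticTwist 1).baseChange ℚ_[7] =
      ((⟨1, 0, -(1 / 2 : ℚ), 0⟩ : VariableChange ℚ).map (algebraMap ℚ ℚ_[7])) • cm7.baseChange ℚ_[7] := by
    rw [← VariableChange.baseChange_smul_eq, completeSquare_smul_cm7]
  rw [e, WeierstrassCurve.localTamagawaNumber_variableChange_holds ℤ_[7] (cm7.baseChange ℚ_[7])]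
  exact localTamagawaNumber_padic_cm7_seven

end SevenEight

/-! ## §2 The place `q`: type `I₀*` with one rational residue root, `c_q = 2` -/

section PlaceQEight

variable {q : ℕ}

/-- `q ≠ 2, 7` ⇒ `q ∤ 5619712 = 2¹⁴·7³` ⇒ `5619712 ≠ 0` in the residue field `𝔽_q` of `ℤ_q`. [folklore] -/
theorem residue_discEight_ne_zero [Fact q.Prime] (hq2 : q ≠ 2) (hq7 : q ≠ 7) :
    (5619712 : ResidueField ℤ_[q]) ≠ 0 := by
  have hq : q.Prime := Fact.out
  intro h0
  have h1 := congrArg (PadicInt.residueField (p := q)) h0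
  rw [map_ofNat, map_zero] at h1
  have h2 : q ∣ 5619712 := (ZMod.natCast_eq_zero_iff 5619712 q).mp (by exact_mod_cast h1)
  have h3 : q ∣ 2 ^ 14 * 7 ^ 3 := by norm_num; exact h2
  rcases (Nat.Prime.dvd_mul hq).mp h3 with h | h
  · exact hq2 ((Nat.prime_dvd_prime_iff_eq hq Nat.prime_two).mp (hq.dvd_of_dvd_pow h))
  · exact hq7 ((Nat.prime_dvd_prime_iff_eq hq (by norm_num)).mp (hq.dvd_of_dvd_pow h))

/-- **The residue cubic `T³ + 6T² − 128T + 512 = (T + 16)(T² − 10T + 32)` has `−16` as its ONLY root in `𝔽_q`** when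
`(−7/q) = −1`: a root of `T² − 10T + 32` would give `(T − 5)² = −7`. [cite: Tate1975, §7 (case 6)] -/
theorem residue_cubicEight_root_iff [Fact q.Prime] (hl7 : legendreSym q (-7) = -1) (r : ResidueField ℤ_[q]) :
    r ^ 3 + 6 * r ^ 2 + (-128) * r + 512 = 0 ↔ r = -16 := by
  constructor
  · intro h
    have hfac : (r + 16) * (r ^ 2 - 10 * r + 32) = 0 := by linear_combination h
    rcases mul_eq_zero.mp hfac with h1 | h2
    · linear_combination h1
    · exfalso
      have hsq : (r - 5) ^ 2 = -7 := by linear_combination h2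
      have h7 : IsSquare ((-7 : ℤ) : ZMod q) := by
        refine ⟨PadicInt.residueField (p := q) (r - 5), ?_⟩
        rw [← sq, ← map_pow, hsq]
        push_cast
        rw [map_neg, map_ofNat]
      exact (legendreSym.eq_neg_one_iff (p := q)).mp hl7 h7
  · rintro rfl
    norm_num

/-- **`[E(ℚ_q) : E₀(ℚ_q)] = 2` for `V′_q = [0, 6q, 0, −128q², 512q³]` over `ℤ_q`** (Step-6 normal form, exact `I₀*` count
with root set `{−16}`), `q ≡ 1 (mod 4)`, `(q/7) = −1`. [cite: Tate1975, §7 (case 6)] [cite: Silverman1994, IV.9.4 Step 6] -/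
theorem index_nonsingularReductionSubgroup_twistEight_q [Fact q.Prime] (hq7 : jacobiSym q 7 = -1)
    (hq4 : q % 4 = 1) :
    ((⟨0, 6 * q, 0, -128 * q ^ 2, 512 * q ^ 3⟩ : WeierstrassCurve ℤ_[q]).nonsingularReductionSubgroup
      (integers_valuationRing_valuation ℤ_[q] ℚ_[q])).index = 2 := by
  have hq : q.Prime := Fact.out
  obtain ⟨hq2, hq7'⟩ := ne_two_and_ne_seven_of_jacobiSym hq7
  have hl7 : legendreSym q (-7) = -1 := by
    rw [jacobiSym.legendreSym.to_jacobiSym, jacobiSym_neg_seven_eq hq hq4]; exact hq7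
  haveI : HenselianLocalRing ℤ_[q] :=
    { is_henselian := fun f hf a₀ h₁ h₂ =>
        HenselianRing.is_henselian (I := IsLocalRing.maximalIdeal ℤ_[q]) f hf a₀ h₁ (h₂.map _) }
  have hJ : (⟨0, 6 * q, 0, -128 * q ^ 2, 512 * q ^ 3⟩ : WeierstrassCurve ℤ_[q]) =
      (⟨0, 6 * q, 0, -128 * q ^ 2, 512 * q ^ 3⟩ : WeierstrassCurve ℤ).map (Int.castRingHom ℤ_[q]) := by
    ext <;> simp [WeierstrassCurve.map]
  have hΔ : (⟨0, 6 * q, 0, -128 * q ^ 2, 512 * q ^ 3⟩ : WeierstrassCurve ℤ_[q]).Δ ≠ 0 := by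
    rw [hJ, map_Δ, twistModelEight_Δ]
    simp only [eq_intCast, ne_eq, Int.cast_eq_zero, neg_eq_zero]
    have := hq.pos
    positivity
  have hdisc : residue ℤ_[q] (6 : ℤ_[q]) ^ 2 * residue ℤ_[q] (-128 : ℤ_[q]) ^ 2 -
      4 * residue ℤ_[q] (-128 : ℤ_[q]) ^ 3 - 4 * residue ℤ_[q] (6 : ℤ_[q]) ^ 3 * residue ℤ_[q] (512 : ℤ_[q]) -
      27 * residue ℤ_[q] (512 : ℤ_[q]) ^ 2 +
      18 * residue ℤ_[q] (6 : ℤ_[q]) * residue ℤ_[q] (-128 : ℤ_[q]) * residue ℤ_[q] (512 : ℤ_[q]) ≠ 0 := by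
    simp only [map_ofNat, map_neg]
    norm_num
    exact residue_discEight_ne_zero hq2 hq7'
  have h := index_Istar_zero_eq_card_add_one (K := ℚ_[q])
    (⟨0, 6 * q, 0, -128 * q ^ 2, 512 * q ^ 3⟩ : WeierstrassCurve ℤ_[q]) PadicInt.irreducible_p
    (α := 0) (β := 6) (γ := 0) (δ := -128) (ε := 512) (by simp) (by simp only; ring) (by simp)
    (by simp only; ring) (by simp only; ring) hΔ hdisc {-16} (fun r => by
      rw [Finset.mem_singleton, ← residue_cubicEight_root_iff hl7 r]
      simp only [map_ofNat, map_neg])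
  rw [h, Finset.card_singleton]

/-- `V′_q ⊗ ℚ ⊗ ℚ_p` is the base change of the `ℤ_p`-model. [folklore] -/
theorem twistModelEight_baseChange_padic (q p : ℕ) [Fact p.Prime] :
    ((⟨0, 6 * q, 0, -128 * q ^ 2, 512 * q ^ 3⟩ : WeierstrassCurve ℤ).baseChange ℚ).baseChange ℚ_[p] =
      (⟨0, 6 * q, 0, -128 * q ^ 2, 512 * q ^ 3⟩ : WeierstrassCurve ℤ_[p]).baseChange ℚ_[p] := by
  ext <;> simp only [baseChange, map_a₁, map_a₂, map_a₃, map_a₄, map_a₆, map_neg, map_mul, map_pow, map_ofNat,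
    map_natCast, map_zero, algebraMap_int_eq]

/-- **`c_q(V′_q) = 2`** (Mathlib's `q`-adics) for `q ≡ 1 (mod 4)` prime with `(q/7) = −1`: the index of §2 is the local
Tamagawa number of the MINIMAL model `V′_q ⊗ ℚ_q` (global minimality, §0). [cite: Silverman1994, IV.9.4 Step 6 and Table 4.1] -/
theorem localTamagawaNumber_padic_twistEight_q [Fact q.Prime] (hq7 : jacobiSym q 7 = -1) (hq4 : q % 4 = 1) :
    (haveI := cm7.isElliptic_quadraticTwist (show (((-(8 * q) : ℤ)) : ℚ) ≠ 0 by
       have := (Fact.out : q.Prime).pos; exact_mod_cast (show (-(8 * (q : ℤ))) ≠ 0 by omega))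
     ((cm7.quadraticTwist (((-(8 * q) : ℤ)) : ℚ)).baseChange ℚ_[q]).localTamagawaNumber ℤ_[q]) = 2 := by
  have hq : q.Prime := Fact.out
  obtain ⟨hq2, hq7'⟩ := ne_two_and_ne_seven_of_jacobiSym hq7
  have hd : (((-(8 * q) : ℤ)) : ℚ) ≠ 0 := by
    have := hq.pos; exact_mod_cast (show (-(8 * (q : ℤ))) ≠ 0 by omega)
  haveI := cm7.isElliptic_quadraticTwist hd
  -- minimality at `q`
  set w : HeightOneSpectrum (𝓞 ℚ) := (primesEquiv (R := 𝓞 ℚ)).symm ⟨q, hq⟩ with hw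
  have hwq : ((primesEquiv w : Nat.Primes) : ℕ) = q := by rw [hw, Equiv.apply_symm_apply]
  haveI : ((⟨0, 6 * q, 0, -128 * q ^ 2, 512 * q ^ 3⟩ : WeierstrassCurve ℤ_[q]).baseChange ℚ_[q]).IsMinimal ℤ_[q] := by
    have hmin := (isGloballyMinimal_twistModelEight hq hq2 hq7').isMinimal w
    have h2 := (isMinimalAt_iff_isMinimal_padic w q hwq _).mp hmin
    rwa [twistModelEight_baseChange_padic] at h2
  have hJ : (1 : VariableChange ℚ_[q]) • (cm7.quadraticTwist (((-(8 * q) : ℤ)) : ℚ)).baseChange ℚ_[q] =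
      (⟨0, 6 * q, 0, -128 * q ^ 2, 512 * q ^ 3⟩ : WeierstrassCurve ℤ_[q]).baseChange ℚ_[q] := by
    rw [one_smul, ← twistModelEight_baseChange, twistModelEight_baseChange_padic]
  rw [LocalIndex.localTamagawaNumber_eq_index_of_smul_eq_baseChange _ _ _ hJ]
  exact index_nonsingularReductionSubgroup_twistEight_q hq7 hq4

end PlaceQEight

end Summit.BirchSwinnertonDyer.BirchSwinnertonDyer.Theorems.GoldfeldGoodTwists

end
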